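import Summits.AnomalousDissipation.AnomalousDissipation.Theses.MirrorVariety
import Literature.Analysis.FluidPDE.GaussianVortexPlanar
import Literature.Analysis.FluidPDE.BurgersVortexSteady

/-!
# Sketch — crux-ideate round 1, ideator 2, crux `TaylorGreenLogLoudStates` (stmt-AnomalousDissipation-14586)

First lemmas of the two idea cards filed by this seat (they only have to ELABORATE; one is proved):

* Card `departure-circuit-lifting`:
  - `NoSmoothClosedThinCore` (design lemma, PROVED): the slender-core balance
    `u_s (δ²)' = −u_s' δ² + 4ν` has no smooth 1-periodic solution pair — a stationary thin vortex
    core on a closed axis of `T³` must pass through axial stagnation points (Burgers DEPARTURE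
    cores where `u_s = 0, u_s' > 0`, FLARES where `u_s = 0, u_s' < 0`): the one-generation witness
    is a CIRCUIT, not a uniformly stretched tube or ring.
  - `GaussianCoreGap`: Gallay–Wayne's uniform transverse gap of the Burgers/Oseen core
    linearisation `L = Δ + ½ξ·∇ + 1` in the Gaussian space `L²(G⁻¹dξ)` (spectrum `{−n/2}`), stated
    with the tree's `strainedVorticityOperator 0` and `gaussVortexProfile`; it is the ν-UNIFORM
    coercivity on which the Lyapunov–Schmidt lifting of the card rests.
* Card `cell-axis-rope-signature`:
  - `KinematicRopeLaw`: the explicit anisotropic Gaussian rope of the KINEMATIC (frozen-velocity)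
    steady vorticity equation in the strain `(−βx, −γy, (β+γ)z)`: flux `Φ`, dissipation per unit
    length `ν∫ω² = Φ²√(βγ)/(4π)` — ν-INDEPENDENT iff both transverse rates are positive (rope
    signature), `→ 0` like `√γ` in the sheet limit.
  - `CoarseRopeSignature` / `transferShape`: the typed shape of the card's Transfer `C⁺ → crux`.
-/

noncomputable section

set_option linter.dupNamespace false

open MeasureTheory Filter Topology
open scoped InnerProductSpace RealInnerProductSpace
open Literature.Analysis.FunctionSpaces Literature.Analysis.FunctionSpaces.Torus

namespace Summit.AnomalousDissipation.AnomalousDissipation.Cruxes.TaylorGreenLogLoudStates.Ideator2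

/-! ## Card `departure-circuit-lifting` -/

/-- **Design lemma (thin-core circuit law).** Along a closed axis of period `1` carrying a
stationary slender Gaussian core of squared radius `δ²(z) > 0`, transported by the axial velocity
`u_s(z)` and stretched at the local axial rate `u_s'(z)` (incompressibility), the steady balance is
`u_s (δ²)' = −u_s' δ² + 4ν` (Lundgren 1982; Moffatt–Kida–Ohkitani 1994: `D δ²/Dt = −σδ² + 4ν`).
Equivalently `(u_s δ²)' = 4ν`, so `u_s δ² = 4νz + C` is affine and cannot be periodic for `ν > 0`:
NO smooth periodic pair `(u_s, δ²)` exists. Consequence (card): every stationary closed thin core on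
`T³` contains axial stagnation points; `δ² = 4νz/u_s` is regular (`= 4ν/u_s'`, a Burgers core) at a
DEPARTURE zero `u_s' > 0` and blows up (the core FLARES) at an ARRIVAL zero `u_s' < 0`. [folklore] -/
def NoSmoothClosedThinCore : Prop :=
  ∀ ν : ℝ, 0 < ν → ∀ u δ2 : ℝ → ℝ, Differentiable ℝ u → Differentiable ℝ δ2 →
    Function.Periodic u 1 → Function.Periodic δ2 1 →
      ¬ ∀ z, u z * deriv δ2 z + deriv u z * δ2 z = 4 * ν

/-- Proof of the design lemma: the product `u·δ²` minus `4νz` has zero derivative, hence is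
constant, contradicting periodicity. [folklore] -/
theorem noSmoothClosedThinCore : NoSmoothClosedThinCore := by
  intro ν hν u δ2 hu hδ hpu hpδ h
  have hd : ∀ z, HasDerivAt (fun z => u z * δ2 z - 4 * ν * z) 0 z := fun z => by
    have h1 : HasDerivAt (fun y => u y * δ2 y) (deriv u z * δ2 z + u z * deriv δ2 z) z :=
      (hu z).hasDerivAt.mul (hδ z).hasDerivAt
    have h2 : HasDerivAt (fun y : ℝ => 4 * ν * y) (4 * ν) z := by
      simpa using (hasDerivAt_id z).const_mul (4 * ν)
    have h3 := h1.sub h2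
    have heq : deriv u z * δ2 z + u z * deriv δ2 z - 4 * ν = 0 := by
      have := h z; linarith
    rw [heq] at h3
    exact h3
  have hconst : (u 1 * δ2 1 - 4 * ν * 1) = (u 0 * δ2 0 - 4 * ν * 0) :=
    is_const_of_deriv_eq_zero (f := fun z => u z * δ2 z - 4 * ν * z)
      (fun z => (hd z).differentiableAt) (fun z => (hd z).deriv) 1 0
  have hu1 : u 1 = u 0 := by simpa using hpu 0
  have hδ1 : δ2 1 = δ2 0 := by simpa using hpδ 0
  rw [hu1, hδ1] at hconst
  linarith

/-- **First lemma of card `departure-circuit-lifting` (uniform transverse core gap; Gallay–Wayne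
2002 §4 / 2005 §4.1: in `L²(G⁻¹ dξ)` the operator `L = Δ_ξ + ½ξ·∇_ξ + 1` is self-adjoint with
spectrum `{−n/2 : n ∈ ℕ}`, kernel spanned by `G`).** Quadratic-form version on mean-zero functions
(`∫ w = 0 ⇔ w ⊥ G` in `L²(G⁻¹)`): `⟨Lw, w⟩_{G⁻¹} ≤ −½ ‖w‖²_{G⁻¹}`. In core variables
`ξ = x/δ`, `δ = (ν/α)^{1/2}` this is the statement that the linearised axisymmetric-sector Burgers
operator at a departure core has gap `α/2` INDEPENDENT OF `ν` — the coercivity the Lyapunov–Schmidt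
lifting uses in the directions transverse to the reduced (skeleton) unknowns.
[cite: GallayWayne2005, §4.1] -/
def GaussianCoreGap : Prop :=
  ∀ w : EuclideanSpace ℝ (Fin 2) → ℝ, ContDiff ℝ 2 w → HasCompactSupport w → ∫ x, w x = 0 →
    ∫ x, (Literature.Analysis.FluidPDE.gaussVortexProfile x)⁻¹ *
        (w x * Literature.Analysis.FluidPDE.strainedVorticityOperator 0 w x)
      ≤ -(1 / 2 : ℝ) * ∫ x, (Literature.Analysis.FluidPDE.gaussVortexProfile x)⁻¹ * w x ^ 2

/-! ## Card `cell-axis-rope-signature` -/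

/-- The **kinematic rope profile** in the departure strain `(−βx, −γy, (β+γ)z)`, `β, γ > 0`:
`ω(x,y) = Φ√(βγ)/(2πν) · exp(−(βx² + γy²)/(2ν))`, total flux `Φ`. [folklore] -/
def ropeProfile (β γ ν Φ : ℝ) (x y : ℝ) : ℝ :=
  Φ * Real.sqrt (β * γ) / (2 * Real.pi * ν) * Real.exp (-(β * x ^ 2 + γ * y ^ 2) / (2 * ν))

/-- **First lemma of card `cell-axis-rope-signature` (kinematic rope law).** For `β, γ, ν > 0` the
profile `ω = ropeProfile β γ ν Φ` solves the steady FROZEN-VELOCITY (kinematic, passive-vector)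
axial vorticity equation in the strain `U = (−βx, −γy, (β+γ)z)`,
`ν Δ_⊥ ω + βx ∂_x ω + γy ∂_y ω + (β+γ) ω = 0` (advection + stretching `ω ∂_z U_z` + diffusion),
has flux `∬ ω = Φ`, and dissipates per unit length `ν ∬ ω² = Φ² √(βγ)/(4π)` — INDEPENDENT OF `ν`
exactly when both transverse contraction rates are positive (rope signature `(−,−,+)`); as the
weaker rate `γ ↓ 0` (sheet signature) the rate vanishes like `√γ`. For `β = γ = α/2` this is the
Burgers value `αΦ²/(8π)` of the tree's `burgersVortex_enstrophy_dissipation`. (Uniqueness among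
integrable solutions of given flux — the OU Liouville property — is the companion statement.)
[folklore] -/
def KinematicRopeLaw : Prop :=
  ∀ β γ ν Φ : ℝ, 0 < β → 0 < γ → 0 < ν →
    (∀ x y : ℝ,
      ν * (deriv (fun s => deriv (fun t => ropeProfile β γ ν Φ t y) s) x
            + deriv (fun s => deriv (fun t => ropeProfile β γ ν Φ x t) s) y)
        + β * x * deriv (fun t => ropeProfile β γ ν Φ t y) x
        + γ * y * deriv (fun t => ropeProfile β γ ν Φ x t) y
        + (β + γ) * ropeProfile β γ ν Φ x y = 0) ∧
    (∫ x, ∫ y, ropeProfile β γ ν Φ x y = Φ) ∧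
    ν * ∫ x, ∫ y, ropeProfile β γ ν Φ x y ^ 2 = Φ ^ 2 * Real.sqrt (β * γ) / (4 * Real.pi)

/-- The Taylor–Green force of the crux, verbatim (as in the sibling crux's `Disproof.tgForce`). -/
def tgForce : UnitAddTorus (Fin 3) → EuclideanSpace ℝ (Fin 3) := fun x =>
  !₂[(fourier 1 (x 0) : ℂ).im * (fourier 1 (x 1) : ℂ).re * (fourier 1 (x 2) : ℂ).re,
    -((fourier 1 (x 0) : ℂ).re * (fourier 1 (x 1) : ℂ).im * (fourier 1 (x 2) : ℂ).re), (0 : ℝ)]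

/-- Band-limitation to the punctured ball (verbatim the crux's clause). -/
def IsBandLimited (N : ℕ) (U : UnitAddTorus (Fin 3) → EuclideanSpace ℝ (Fin 3)) : Prop :=
  ∀ k ∉ (freqBall N).erase (0 : Fin 3 → ℤ),
    UnitAddTorus.mFourierCoeff (Literature.Analysis.FunctionSpaces.EuclideanSpace.complexify ∘ U) k = 0

/-- Admissible Galerkin steady state at `(ν, N)` for the force `f` (verbatim the crux's bracket). -/
def IsSteadyState (ν : ℝ) (N : ℕ) (f U : UnitAddTorus (Fin 3) → EuclideanSpace ℝ (Fin 3)) : Prop :=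
  IsSmooth U ∧ IsDivFree U ∧ HasZeroMean U ∧ IsBandLimited N U ∧
    ∀ a : UnitAddTorus (Fin 3) → EuclideanSpace ℝ (Fin 3), IsSmooth a → IsDivFree a → IsBandLimited N a →
      ∫ x, (⟪U x, convect U a x⟫_ℝ + ν * ⟪U x, laplacian a x⟫_ℝ + ⟪f x, a x⟫_ℝ) = 0

/-- The centre `p = (¼, ¼, ¼)` of the Taylor–Green cell `[0,½]³` (the mid-height point of the cell's
swirl axis `x = y = ¼`; `u_TG(p) = 0` and `∇u_TG(p) = 0`). -/
def cellCentre : UnitAddTorus (Fin 3) := fun _ => ((1 / 4 : ℝ) : UnitAddCircle)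

/-- **Typed shape of the Transfer `C⁺` of card `cell-axis-rope-signature` (schematic but complete).**
Along some `ν_j → 0⁺` there are log-energy admissible Taylor–Green Galerkin states at all large `N`
whose LOW-PASS part `P_{K₀}U` converges in `C¹` (tolerance `τ_j → 0`) to a smooth divergence-free
coarse flow `V` which, at the cell centre `p`, (i) vanishes, (ii) has the axisymmetric DEPARTURE
gradient `diag(−α/2, −α/2, α)`, `α > 0` (von Kármán topology: radial inflow in the mid-plane, axial
pumping toward the faces), and (iii) supplies axial vorticity: `∂_z (curl V)_z (p) ≠ 0` (the column
vorticity `≈ 4πA cos 2πz` of the cell changes sign linearly across the mid-plane, so the two ropes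
departing from `p` entrain counter-signed flux `Φ(z) ≠ 0`). The LOUDNESS clause of the crux is
absent: the card's sandwich lemma is `C⁺ → crux` with `c = c(α, ∂_z(curl V)_z(p), V) > 0`. -/
def CoarseRopeSignature : Prop :=
  ∃ (ν τ : ℕ → ℝ) (E α : ℝ) (K₀ : ℕ) (V : UnitAddTorus (Fin 3) → EuclideanSpace ℝ (Fin 3)),
    (∀ j, 0 < ν j ∧ ν j ≤ 1 / 4) ∧ Tendsto ν atTop (𝓝 0) ∧ Tendsto τ atTop (𝓝 0) ∧ 0 < α ∧
    IsSmooth V ∧ IsDivFree V ∧ V cellCentre = 0 ∧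
    (∀ i l : Fin 3, Torus.partialDeriv i V cellCentre l =
        if i = l then ![-(α / 2), -(α / 2), α] l else 0) ∧
    Torus.partialDeriv 2
        (fun x => Torus.partialDeriv 0 V x 1 - Torus.partialDeriv 1 V x 0) cellCentre ≠ 0 ∧
    ∀ j, ∀ᶠ N in atTop, ∃ U : UnitAddTorus (Fin 3) → EuclideanSpace ℝ (Fin 3),
      IsSteadyState (ν j) N tgForce U ∧ ∫ x, ‖U x‖ ^ 2 ≤ E * Real.log (1 / ν j) ∧
      ∀ (x : UnitAddTorus (Fin 3)) (i : Fin 3),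
        ‖fourierTruncate K₀ U x - V x‖ ≤ τ j ∧
        ‖Torus.partialDeriv i (fourierTruncate K₀ U) x - Torus.partialDeriv i V x‖ ≤ τ j

/-- The transfer the card proposes, as an implication to the crux BY NAME (elaboration check only;
its proof is the card's sandwich lemma, a stub of the future line). -/
def transferShape : Prop :=
  CoarseRopeSignature →
    Summit.AnomalousDissipation.AnomalousDissipation.Theses.MirrorVariety.TaylorGreenLogLoudStates

end Summit.AnomalousDissipation.AnomalousDissipation.Cruxes.TaylorGreenLogLoudStates.Ideator2

end
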